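import Mathlib
import HarnessLib
import Literature.MathematicalPhysics.QuantumLattice.KohnLuttinger
import Literature.MathematicalPhysics.QuantumLattice.FermiRG.FST2Hypotheses
import Summits.HubbardSuperconductivity.HubbardSuperconductivity.Theorems.WeakCouplingBCSKlCertTPrimeConvexityA3
import Summits.HubbardSuperconductivity.HubbardSuperconductivity.Theorems.WeakCouplingBCSKlCertTPrimeCurvatureQuadratic
import Summits.HubbardSuperconductivity.HubbardSuperconductivity.Theorems.KLProgrammeFermiSurfaceDopingWindow
import Summits.HubbardSuperconductivity.HubbardSuperconductivity.Theorems.KLProgrammeKLRegimeSplitConsts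

/-!
# KL-MARGIN-SCAN, reader seat hubbard-klscan-idea-4 (lens «cascade»), round 6 — Sketch:
# the FST II GEOMETRIC TICKET of a `t`–`t′` scan cell on the engine's TUBE (crux idea «geom-ticket-chart»)

The only typed object through which a certified Kohn–Luttinger margin cell could enter a sector/Fermi-liquid engine of the
K3 architecture (route KLProgramme, `…Theorems.KLRegimeSplit.FrameOK`) is NOT a statement about the Fermi curve `{ε = μ}` but
about a TUBE: `FermiRG.GeomConstants e K r₀ g₀ w` — `|∇e| ≥ g₀` and tangential Hessian `≥ w‖t‖²` on `{|e| < r₀}` — with the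
engine's literal numerics `(K, r₀, g₀, w) = (7, 3/80, 1/2, 3/200)` (`FrameOK`, "half the free band's constants"), tube radius
`3/80 > klE0 = 1/32` = the top of the scale ladder `Λ_n = 4^{-n}/32`.  Rounds 3–4 of this seat decided the SIGN of the curvature
numerator AT the Fermi level (`KLInflectionTP`, `farGamma_hypA3`, `Mside_hypA3_neg`).  This file types the tube layer:

* §0 `geomConstants_weaken`; the orientation-free ticket `KLGeomTicketTP tp μ r₀ g₀ w` and `KLFrameTicketTP` (FrameOK numerics).
* §1 three tube-level NO-GO mechanisms for the free band `ε_{t′}` (hopping 1), each for both orientations `±(ε_{t′} − μ)`: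
  (VH) the saddle `(π,0)` in the tube, `|4t′ − μ| < r₀` ⇒ no ticket (speed floor); (CR) an INFLECTED shell in the tube,
  `μ_c(t′) < μ' < 4t′`, `|μ' − μ| < r₀` ⇒ no ticket (Hessian floor; uses `gammaSide_inflection`); (OR) an M-side shell in the
  tube ⇒ no ticket in the electron orientation `ε − μ` (uses `Mside_curvNum_neg`); plus the slow-point lemma.
* §2 the NODAL RATE LAW: any ticket has `w ≤ 2(cos x_d + 2t′)` at every regular diagonal point `(x_d, x_d)` of a shell inside the
  tube — the admissible Hessian floor tends to `0` linearly at the convexity-return level; at `t′ = 0` it reads `w ≤ −μ'/2`, so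
  fs-1's window constant `w = 0.0443` on the tube `r₀ = 0.0887` at `μ = −0.1775` is sharp to `2·10⁻⁴`.
* §3 cell verdicts of KL-MARGIN-SCAN (exact rationals; `μ`-intervals contain margin-1 g14's certified brackets):
  `t′ = 0`, `δ ∈ [0.10, 0.20]`: the free band HAS the FrameOK ticket `(7, 3/80, 1/2, 3/200)` (by name, from
  `klfs_dwin_geomConstants`); `(1/8, −0.18)`: saddle in the `3/80`-tube; `(1/8, −0.2)` (director target 2): saddle in fs-1's
  `0.0887`-tube AND a point of speed `< 1/2` in the `3/80`-tube ⇒ no FrameOK-numerics ticket in either orientation although the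
  cell is VH-distance `0.063` («not VH-excluded» in SCAN-TABLE v0.x) and strictly convex; `(0.275, −0.1)` and the (iii) node
  `(1/8, −0.04)`: convex AT the level (round 4: (A3) holds) but an inflected shell inside the `klE0 = 1/32` tube ⇒ no ticket at the
  engine's top scale; `(0.30, −0.1)`: admissible but `w ≤ 0.022` on the `3/80` tube (vs `0.34` for its `t′ = 0` sibling);
  `(1/8, −0.3)` (director target 1, funded): the electron orientation fails at every radius, the hole orientation `μ − ε` is the
  ticket to type (float floors on the `3/80` tube: `g₀ ≥ 1.12`, `w ≥ 0.49` — the best-conditioned cell of the scan).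

Honest framing.  Elementary real analysis of the one-band dispersion and the typed predicate `FermiRG.GeomConstants`; floats quoted
in docstrings are floats.  Nothing here asserts a Kohn–Luttinger margin at `t′ ≠ 0`, K₃, `U₀`, the window or superconductivity; a
Kohn–Luttinger instability statement is not ODLRO and nothing here proves superconductivity in the Hubbard model; no `t′ ≠ 0`
statement chains to the summit Statement (`squareDispersion 1 0`); `FrameOK` itself is typed for `t′ = 0` only (`frameLevel`).

References: J. Feldman, M. Salmhofer, E. Trubowitz, Comm. Pure Appl. Math. 52 (1999) 273 (FST II), Lemma 2.1 and (gzerinit)/(wz)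
(tree: `FermiRG.FST2Hypotheses.GeomConstants`); M. Salmhofer, Rev. Math. Phys. 10 (1998) 553, §2; G. Benfatto, A. Giuliani,
V. Mastropietro, Ann. Henri Poincaré 4 (2003) 137, §1.2 (tree: `BGM2003.DispersionHyp`); this seat's rounds 3–4
(`…Theorems.WeakCouplingBCSKlCertTPrimeConvexity{,A3}`, `…CurvatureQuadratic{,FarGamma}`).
-/

noncomputable section

set_option linter.dupNamespace false

namespace Summit.HubbardSuperconductivity.HubbardSuperconductivity.Theorems.KlTPrimeGeomTicket

open Real Set Literature.MathematicalPhysics.QuantumLattice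
open Summit.HubbardSuperconductivity.HubbardSuperconductivity.Theorems.KlTPrimeConvexity

/-! ### §0  Weakening; the orientation-free ticket -/

/-- `GeomConstants` is monotone in its constants (larger `K`, smaller `r₀, g₀, w`). [folklore] -/
theorem geomConstants_weaken {e : Momentum → ℝ} {K r₀ g₀ w K' r₀' g₀' w' : ℝ}
    (h : FermiRG.GeomConstants e K r₀ g₀ w) (hK : K ≤ K') (hr : r₀' ≤ r₀) (hr' : 0 < r₀')
    (hg : g₀' ≤ g₀) (hg' : 0 < g₀') (hw : w' ≤ w) (hw' : 0 < w') :
    FermiRG.GeomConstants e K' r₀' g₀' w' where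
  r₀_pos := hr'
  g₀_pos := hg'
  wmin_pos := hw'
  norm_iteratedFDeriv_le := fun p j hj => (h.norm_iteratedFDeriv_le p j hj).trans hK
  le_norm_gradient := fun p hp => hg.trans (h.le_norm_gradient p (hp.trans_le hr))
  le_hessQuad := fun p hp t ht =>
    (mul_le_mul_of_nonneg_right hw (sq_nonneg _)).trans (h.le_hessQuad p (hp.trans_le hr) t ht)

/-- The ORIENTATION-FREE FST II ticket of the `t`–`t′` cell `(t′, μ)` on the tube of radius `r₀` with floors `(g₀, w)` and
FrameOK's derivative bound `7`: electron orientation `ε_{t′} − μ` or hole orientation `μ − ε_{t′}`. [folklore] -/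
def KLGeomTicketTP (tp μ r₀ g₀ w : ℝ) : Prop :=
  FermiRG.GeomConstants (fun q : Momentum => squareDispersion 1 tp q - μ) 7 r₀ g₀ w ∨
  FermiRG.GeomConstants (fun q : Momentum => -(squareDispersion 1 tp q - μ)) 7 r₀ g₀ w

/-- The ticket with the K3 engine's literal `FrameOK` numerics `(7, 3/80, 1/2, 3/200)` on the FREE `t`–`t′` band. [folklore] -/
def KLFrameTicketTP (tp μ : ℝ) : Prop := KLGeomTicketTP tp μ (3 / 80) (1 / 2) (3 / 200)

/-! ### §1  Tube-level no-go mechanisms -/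

/-- `‖∇(ε_{t′} − μ)(p)‖² = ε_x(p)² + ε_y(p)²`. [folklore] -/
theorem norm_sq_gradient_e (tp μ : ℝ) (p : Momentum) :
    ‖gradient (fun q : Momentum => squareDispersion 1 tp q - μ) p‖ ^ 2 = dx tp (p 0) (p 1) ^ 2 + dy tp (p 0) (p 1) ^ 2 := by
  have hg : gradient (fun q : Momentum => squareDispersion 1 tp q - μ) p = gradient (squareDispersion 1 tp) p := by
    unfold gradient; rw [fderiv_sub_const]
  rw [hg, Summit.HubbardSuperconductivity.HubbardSuperconductivity.Theorems.klph_gradient_squareDispersion,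
    EuclideanSpace.real_norm_sq_eq, Fin.sum_univ_two]
  simp [dx, dy]

/-- The gradient norm is orientation-free: `‖∇(−e)(p)‖ = ‖∇e(p)‖`. [folklore] -/
theorem norm_gradient_neg (e : Momentum → ℝ) (p : Momentum) :
    ‖gradient (fun q : Momentum => -(e q)) p‖ = ‖gradient e p‖ := by
  have hfun : (fun q : Momentum => -(e q)) = -e := rfl
  rw [hfun]
  unfold gradient
  rw [fderiv_neg, map_neg, norm_neg]

/-- A SLOW POINT in the tube kills the ticket: `|e p| < r₀`, `‖∇e p‖ < g₀` ⇒ `¬ GeomConstants e K r₀ g₀ w`. [folklore] -/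
theorem not_geomConstants_of_slow_point {e : Momentum → ℝ} {K r₀ g₀ w : ℝ} (p : Momentum) (hp : |e p| < r₀)
    (hslow : ‖gradient e p‖ < g₀) : ¬ FermiRG.GeomConstants e K r₀ g₀ w :=
  fun hG => absurd (hG.le_norm_gradient p hp) (not_le.mpr hslow)

/-- Slow point, hole orientation. [folklore] -/
theorem not_geomConstants_neg_of_slow_point {e : Momentum → ℝ} {K r₀ g₀ w : ℝ} (p : Momentum) (hp : |e p| < r₀)
    (hslow : ‖gradient e p‖ < g₀) : ¬ FermiRG.GeomConstants (fun q : Momentum => -(e q)) K r₀ g₀ w :=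
  not_geomConstants_of_slow_point p (by rw [abs_neg]; exact hp) (by rw [norm_gradient_neg]; exact hslow)

/-- The saddle: `ε_{t′}(π, 0) = 4t′` (the Van Hove level). [folklore] -/
theorem squareDispersion_saddle (tp : ℝ) : squareDispersion 1 tp (mk π 0) = 4 * tp := by
  simp [squareDispersion]

/-- The saddle is a critical point: `‖∇(ε_{t′} − μ)(π, 0)‖ = 0`. [folklore] -/
theorem norm_gradient_e_saddle (tp μ : ℝ) : ‖gradient (fun q : Momentum => squareDispersion 1 tp q - μ) (mk π 0)‖ = 0 := by
  have h := norm_sq_gradient_e tp μ (mk π 0)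
  simp only [mk_apply_zero, mk_apply_one, dx, dy, sin_pi, sin_zero] at h
  have h0 : ‖gradient (fun q : Momentum => squareDispersion 1 tp q - μ) (mk π 0)‖ ^ 2 = 0 := by rw [h]; ring
  exact pow_eq_zero_iff (n := 2) (by norm_num) |>.mp h0

/-- **(VH) no-go**: the Van Hove saddle inside the tube, `|4t′ − μ| < r₀`, kills every ticket (electron orientation). [folklore] -/
theorem not_geomConstants_of_saddle_mem_tube {tp μ r₀ K g₀ w : ℝ} (h : |4 * tp - μ| < r₀) :
    ¬ FermiRG.GeomConstants (fun q : Momentum => squareDispersion 1 tp q - μ) K r₀ g₀ w := by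
  intro hG
  refine not_geomConstants_of_slow_point (e := fun q : Momentum => squareDispersion 1 tp q - μ) (mk π 0) ?_ ?_ hG
  · rw [squareDispersion_saddle]; exact h
  · rw [norm_gradient_e_saddle]; exact hG.g₀_pos

/-- **(VH) no-go, hole orientation.** [folklore] -/
theorem not_geomConstants_neg_of_saddle_mem_tube {tp μ r₀ K g₀ w : ℝ} (h : |4 * tp - μ| < r₀) :
    ¬ FermiRG.GeomConstants (fun q : Momentum => -(squareDispersion 1 tp q - μ)) K r₀ g₀ w := by
  intro hG
  refine not_geomConstants_neg_of_slow_point (e := fun q : Momentum => squareDispersion 1 tp q - μ) (mk π 0) ?_ ?_ hG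
  · rw [squareDispersion_saddle]; exact h
  · rw [norm_gradient_e_saddle]; exact hG.g₀_pos

/-- **(CR) no-go**: an INFLECTED shell inside the tube — a level `μ'` with `μ_c(t′) < μ' < 4t′` and `|μ' − μ| < r₀` — kills every
ticket in the electron orientation (its nodal point has a negative tangential Hessian, `gammaSide_inflection`). [folklore] -/
theorem not_geomConstants_of_inflected_shell {tp μ μ' r₀ K g₀ w : ℝ} (htp1 : -1 / 2 < tp) (htp0 : tp < 0)
    (hlo : convexityReturnLevel tp < μ') (hhi : μ' < 4 * tp) (hr : |μ' - μ| < r₀) :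
    ¬ FermiRG.GeomConstants (fun q : Momentum => squareDispersion 1 tp q - μ) K r₀ g₀ w := by
  intro hG
  obtain ⟨k, hk, -, -, hneg, -⟩ := gammaSide_inflection htp1 htp0 hlo hhi
  have hek : |squareDispersion 1 tp k - μ| < r₀ := by rw [hk.2]; exact hr
  have h1 := hG.le_hessQuad k hek (tvec tp (k 0) (k 1)) (inner_gradient_tvec tp μ k)
  rw [hessQuad_tvec] at h1
  have h2 : 0 ≤ w * ‖tvec tp (k 0) (k 1)‖ ^ 2 := mul_nonneg hG.wmin_pos.le (sq_nonneg _)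
  linarith

/-- **(CR) no-go, hole orientation**: the same inflected shell kills the hole-orientation ticket (its antinodal axis point has a
positive numerator, i.e. a negative tangential Hessian for `μ − ε`). [folklore] -/
theorem not_geomConstants_neg_of_inflected_shell {tp μ μ' r₀ K g₀ w : ℝ} (htp1 : -1 / 2 < tp) (htp0 : tp < 0)
    (hlo : convexityReturnLevel tp < μ') (hhi : μ' < 4 * tp) (hr : |μ' - μ| < r₀) :
    ¬ FermiRG.GeomConstants (fun q : Momentum => -(squareDispersion 1 tp q - μ)) K r₀ g₀ w := by
  intro hG
  obtain ⟨-, -, k, hk, -, hposN⟩ := gammaSide_inflection htp1 htp0 hlo hhi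
  have hek : |-(squareDispersion 1 tp k - μ)| < r₀ := by rw [abs_neg, hk.2]; exact hr
  have hfun : (fun q : Momentum => -(squareDispersion 1 tp q - μ)) = -(fun q : Momentum => squareDispersion 1 tp q - μ) := rfl
  have horth : inner ℝ (gradient (fun q : Momentum => -(squareDispersion 1 tp q - μ)) k) (tvec tp (k 0) (k 1)) = 0 := by
    rw [hfun]
    unfold gradient
    rw [fderiv_neg, map_neg, inner_neg_left]
    have := inner_gradient_tvec tp μ k
    unfold gradient at this
    rw [this, neg_zero]
  have h1 := hG.le_hessQuad k hek _ horth
  rw [FermiRG.hessQuad, hfun, iteratedFDeriv_neg_apply, neg_apply] at h1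
  have h3 := hessQuad_tvec tp μ k
  rw [FermiRG.hessQuad] at h3
  rw [h3] at h1
  have h2 : 0 ≤ w * ‖tvec tp (k 0) (k 1)‖ ^ 2 := mul_nonneg hG.wmin_pos.le (sq_nonneg _)
  linarith

/-- An inflected shell in the tube kills the orientation-free ticket. [folklore] -/
theorem not_ticket_of_inflected_shell {tp μ μ' r₀ g₀ w : ℝ} (htp1 : -1 / 2 < tp) (htp0 : tp < 0)
    (hlo : convexityReturnLevel tp < μ') (hhi : μ' < 4 * tp) (hr : |μ' - μ| < r₀) : ¬ KLGeomTicketTP tp μ r₀ g₀ w := by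
  rintro (h | h)
  · exact not_geomConstants_of_inflected_shell htp1 htp0 hlo hhi hr h
  · exact not_geomConstants_neg_of_inflected_shell htp1 htp0 hlo hhi hr h

/-- The saddle in the tube kills the orientation-free ticket. [folklore] -/
theorem not_ticket_of_saddle_mem_tube {tp μ r₀ g₀ w : ℝ} (h : |4 * tp - μ| < r₀) : ¬ KLGeomTicketTP tp μ r₀ g₀ w := by
  rintro (hG | hG)
  · exact not_geomConstants_of_saddle_mem_tube h hG
  · exact not_geomConstants_neg_of_saddle_mem_tube h hG

/-- The axis through the saddle: `ε_{t′}(π, y) = 2 − (2 − 4t′) cos y`. [folklore] -/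
theorem squareDispersion_axis_pi (tp y : ℝ) : squareDispersion 1 tp (mk π y) = 2 - (2 - 4 * tp) * cos y := by
  simp [squareDispersion]
  ring

/-- Every M-side level `4t′ < μ' < 4 − 4t′` is attained on the axis `k₀ = π`. [folklore] -/
theorem exists_axis_pi_point {tp μ' : ℝ} (hlo : 4 * tp < μ') (hhi : μ' < 4 - 4 * tp) :
    ∃ y ∈ Ioo 0 π, squareDispersion 1 tp (mk π y) = μ' := by
  let g : ℝ → ℝ := fun y => squareDispersion 1 tp (mk π y)
  have hg : Continuous g := by
    have : g = fun y => 2 - (2 - 4 * tp) * cos y := by funext y; exact squareDispersion_axis_pi tp y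
    rw [this]; fun_prop
  have h0 : g 0 = 4 * tp := by
    show squareDispersion 1 tp (mk π 0) = 4 * tp
    rw [squareDispersion_axis_pi, cos_zero]; ring
  have hπ : g π = 4 - 4 * tp := by
    show squareDispersion 1 tp (mk π π) = 4 - 4 * tp
    rw [squareDispersion_axis_pi, cos_pi]; ring
  have hsub := intermediate_value_Ioo pi_pos.le hg.continuousOn
  rw [h0, hπ] at hsub
  exact hsub ⟨hlo, hhi⟩

/-- **(OR) orientation no-go**: an M-side shell inside the tube (`4t′ < μ' < 4t′ + 32|t′|(1 − 4t′²)`, `μ' < 4 − 4t′`,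
`|μ' − μ| < r₀`) kills the ELECTRON-orientation ticket `ε_{t′} − μ` (the curve there is hole-like: `Mside_curvNum_neg`); the
hole orientation `μ − ε_{t′}` is the one an engine must carry on M-side cells. [folklore] -/
theorem not_geomConstants_pos_of_Mside_shell {tp μ μ' r₀ K g₀ w : ℝ} (htp1 : -1 / 2 < tp) (htp0 : tp < 0)
    (hlo : 4 * tp < μ') (hdisc : μ' - 4 * tp < 32 * |tp| * (1 - 4 * tp ^ 2)) (htop : μ' < 4 - 4 * tp)
    (hr : |μ' - μ| < r₀) :
    ¬ FermiRG.GeomConstants (fun q : Momentum => squareDispersion 1 tp q - μ) K r₀ g₀ w := by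
  intro hG
  obtain ⟨y, -, hε⟩ := exists_axis_pi_point hlo htop
  have hneg := Mside_curvNum_neg htp1 htp0 hlo hdisc hε
  have hek : |squareDispersion 1 tp (mk π y) - μ| < r₀ := by rw [hε]; exact hr
  have h1 := hG.le_hessQuad (mk π y) hek _ (inner_gradient_tvec tp μ (mk π y))
  rw [hessQuad_tvec] at h1
  have h2 : 0 ≤ w * ‖tvec tp ((mk π y) 0) ((mk π y) 1)‖ ^ 2 := mul_nonneg hG.wmin_pos.le (sq_nonneg _)
  linarith

/-! ### §2  The nodal rate law: an upper bound on every admissible Hessian floor -/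

/-- `‖(a, b)‖² = a² + b²` for the explicit point `mk a b`. [folklore] -/
theorem norm_sq_mk (a b : ℝ) : ‖KlTPrimeConvexity.mk a b‖ ^ 2 = a ^ 2 + b ^ 2 := by
  rw [KlTPrimeConvexity.mk, EuclideanSpace.real_norm_sq_eq, Fin.sum_univ_two]
  simp

/-- `‖(−ε_y, ε_x)‖² = ε_x² + ε_y²`. [folklore] -/
theorem norm_sq_tvec (tp x y : ℝ) : ‖tvec tp x y‖ ^ 2 = dx tp x y ^ 2 + dy tp x y ^ 2 := by
  rw [tvec, norm_sq_mk]
  ring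

/-- At a diagonal point the curvature numerator is `2(cos x + 2t′)` times the squared speed. [folklore] -/
theorem curvNum_diag_eq_speed (tp x : ℝ) :
    curvNum tp x x = 2 * (cos x + 2 * tp) * (dx tp x x ^ 2 + dy tp x x ^ 2) := by
  rw [curvNum_diag]
  simp only [dx, dy]
  ring

/-- **NODAL RATE LAW.**  Any electron-orientation ticket on the tube of radius `r₀` about level `μ` has
`w ≤ 2(cos x_d + 2t′)` at every regular diagonal point `(x_d, x_d)` of a shell `μ'` with `|μ' − μ| < r₀`; since
`cos x_d + 2t′ ↓ 0` as `μ' ↑ μ_c(t′)` (`nodal_neg_iff`), the admissible Hessian floor of a Γ-side cell vanishes linearly at the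
convexity-return distance. [folklore] -/
theorem wmin_le_nodal {tp μ μ' r₀ K g₀ w x : ℝ} (htp : |tp| < 1 / 2) (hx0 : 0 < x) (hxπ : x < π)
    (hG : FermiRG.GeomConstants (fun q : Momentum => squareDispersion 1 tp q - μ) K r₀ g₀ w)
    (hlev : squareDispersion 1 tp (mk x x) = μ') (hr : |μ' - μ| < r₀) : w ≤ 2 * (cos x + 2 * tp) := by
  have hek : |squareDispersion 1 tp (mk x x) - μ| < r₀ := by rw [hlev]; exact hr
  have h1 := hG.le_hessQuad (mk x x) hek _ (inner_gradient_tvec tp μ (mk x x))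
  rw [hessQuad_tvec] at h1
  simp only [mk_apply_zero, mk_apply_one] at h1
  rw [norm_sq_tvec, curvNum_diag_eq_speed] at h1
  have hpos : 0 < dx tp x x ^ 2 + dy tp x x ^ 2 := by
    have hs : 0 < sin x := sin_pos_of_pos_of_lt_pi hx0 hxπ
    have hc := one_add_two_tp_cos_pos htp x
    have : 0 < dx tp x x := by unfold dx; positivity
    positivity
  exact le_of_mul_le_mul_right h1 hpos

/-- The nearest-neighbour case of the rate law: `w ≤ −μ'/2` for every shell `−4 < μ' < 4`... inside the tube (take `cos x_d = −μ'/4`).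
In particular fs-1's window constants `(r₀, w) = (−μ/2, −μ/4)` saturate it at the outer shell `μ' = μ/2`. [folklore] -/
theorem nn_wmin_le {μ μ' r₀ K g₀ w : ℝ} (hμ'1 : -4 < μ') (hμ'2 : μ' < 4)
    (hG : FermiRG.GeomConstants (fun q : Momentum => squareDispersion 1 0 q - μ) K r₀ g₀ w) (hr : |μ' - μ| < r₀) :
    w ≤ -μ' / 2 := by
  set x : ℝ := arccos (-μ' / 4) with hx
  have hcos : cos x = -μ' / 4 := cos_arccos (by linarith) (by linarith)
  have hx0 : 0 < x := arccos_pos.mpr (by linarith)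
  have hxπ : x < π := arccos_lt_pi.mpr (by linarith)
  have hlev : squareDispersion 1 0 (mk x x) = μ' := by rw [squareDispersion_diag, hcos]; ring
  have h := wmin_le_nodal (tp := 0) (by norm_num) hx0 hxπ hG hlev hr
  rw [hcos] at h
  linarith

/-- fs-1's `w = 0.0443` on the tube `r₀ = 0.0887` at the doping-window end `μ = −0.1775` (`klfs_dwin_geomConstants`) is sharp to
`2·10⁻⁴`: NO ticket there has `w > 0.0445` (shell `μ' = −0.089`). [folklore] -/
theorem nn_dwin_wmin_sharp {K g₀ w : ℝ}
    (hG : FermiRG.GeomConstants (fun q : Momentum => squareDispersion 1 0 q - (-0.1775)) K 0.0887 g₀ w) : w ≤ 0.0445 := by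
  have h := nn_wmin_le (μ' := -0.089) (by norm_num) (by norm_num) hG (by norm_num [abs_of_pos])
  linarith

/-! ### §3  Cell verdicts of KL-MARGIN-SCAN (exact rationals) -/

/-- **`t′ = 0`: the critical levels COINCIDE** (`μ_c(0) = 0 = 4·0`): convexity-return level = Van Hove level, which is why a single
«VH-EXCLUDED» rule sufficed on the `t′ = 0` table; for `t′ < 0` they split by `4|t′|(1 − 4t′²)`. [folklore] -/
theorem nn_critical_levels_coincide : convexityReturnLevel 0 = 4 * 0 := by norm_num [convexityReturnLevel]

/-- The gap between the two critical levels: `4t′ − μ_c(t′) = −4t′(1 − 4t′²)` (`= 0.384, 0.672, 0.768` at `t′ = −0.1, −0.2, −0.3`). [folklore] -/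
theorem vanHove_sub_convexityReturnLevel (tp : ℝ) : 4 * tp - convexityReturnLevel tp = -4 * tp * (1 - 4 * tp ^ 2) := by
  unfold convexityReturnLevel; ring

/-- **`t′ = 0` column PASSES by name**: on fs-1's doping window `μ ∈ [−0.4275, −0.1775]` (scan cells `(δ, 0)`, `δ = 0.10 … 0.20`)
the FREE band carries the K3 engine's FrameOK numerics `GeomConstants (ε − μ) 7 (3/80) (1/2) (3/200)`
(weakening `klfs_dwin_geomConstants : GeomConstants (ε − μ) 4.4275 0.0887 0.575 0.0443`). [folklore] -/
theorem nn_frameTicket {μ : ℝ} (hμ : μ ∈ Icc (-0.4275 : ℝ) (-0.1775)) : KLFrameTicketTP 0 μ :=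
  Or.inl (geomConstants_weaken (Summit.HubbardSuperconductivity.HubbardSuperconductivity.Theorems.klfs_dwin_geomConstants hμ)
    (by norm_num) (by norm_num) (by norm_num) (by norm_num) (by norm_num) (by norm_num) (by norm_num))

/-- Scan cell `(δ, t′) = (1/8, −0.18)` (`μ ∈ [−0.6854, −0.6853]` ⊇ margin-1's bracket; VH distance `0.0347 < 3/80`): the saddle
lies in the engine's `3/80`-tube ⇒ NO FrameOK-radius ticket in either orientation, for any floors. [folklore] -/
theorem cell_d0125_tpm018_no_ticket {μ g₀ w : ℝ} (hμ : μ ∈ Icc (-0.6854 : ℝ) (-0.6853)) :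
    ¬ KLGeomTicketTP (-18 / 100) μ (3 / 80) g₀ w :=
  not_ticket_of_saddle_mem_tube (by rw [abs_lt]; constructor <;> linarith [hμ.1, hμ.2])

/-- Scan cell `(1/8, −0.2)` = director target 2 (`μ ∈ [−0.7367, −0.7366]`, VH distance `0.063`): the saddle lies in fs-1's free
tube of radius `0.0887` ⇒ no ticket at the doping-window radius, either orientation. [folklore] -/
theorem cell_d0125_tpm02_no_dwinRadius_ticket {μ g₀ w : ℝ} (hμ : μ ∈ Icc (-0.7367 : ℝ) (-0.7366)) :
    ¬ KLGeomTicketTP (-2 / 10) μ 0.0887 g₀ w :=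
  not_ticket_of_saddle_mem_tube (by rw [abs_lt]; constructor <;> linarith [hμ.1, hμ.2])

/-- Scan cell `(1/8, −0.2)`: the axis point `(π, arccos 0.99)` lies in the `3/80`-tube (level `−0.772`) and has speed
`2.8·√0.0199 ≈ 0.395 < 1/2` ⇒ the FREE band fails FrameOK's literal `(r₀, g₀) = (3/80, 1/2)` in BOTH orientations (and a
fortiori the `O(U)`-perturbed frame does): NO `KLFrameTicketTP`.  The cell is strictly convex and «not VH-excluded» in SCAN-TABLE
v0.x (threshold `0.025`); the engine's tube is what excludes it. [folklore] -/
theorem cell_d0125_tpm02_no_frameTicket {μ : ℝ} (hμ : μ ∈ Icc (-0.7367 : ℝ) (-0.7366)) : ¬ KLFrameTicketTP (-2 / 10) μ := by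
  have hc : cos (arccos (99 / 100 : ℝ)) = 99 / 100 := cos_arccos (by norm_num) (by norm_num)
  have hs : sin (arccos (99 / 100 : ℝ)) = √(1 - (99 / 100) ^ 2) := sin_arccos _
  have hlev : |squareDispersion 1 (-2 / 10) (mk π (arccos (99 / 100))) - μ| < 3 / 80 := by
    rw [squareDispersion_axis_pi, hc, abs_lt]
    constructor <;> linarith [hμ.1, hμ.2]
  have hslow : ‖gradient (fun q : Momentum => squareDispersion 1 (-2 / 10) q - μ) (mk π (arccos (99 / 100)))‖ < 1 / 2 := by
    have h2 := norm_sq_gradient_e (-2 / 10) μ (mk π (arccos (99 / 100)))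
    simp only [mk_apply_zero, mk_apply_one, dx, dy, sin_pi, cos_pi, hs] at h2
    have hsq : (√(1 - (99 / 100 : ℝ) ^ 2)) ^ 2 = 1 - (99 / 100) ^ 2 := sq_sqrt (by norm_num)
    have h3 : ‖gradient (fun q : Momentum => squareDispersion 1 (-2 / 10) q - μ) (mk π (arccos (99 / 100)))‖ ^ 2 < (1 / 2) ^ 2 := by
      rw [h2]; nlinarith [hsq]
    exact lt_of_pow_lt_pow_left₀ 2 (by norm_num) h3
  rintro (hG | hG)
  · exact not_geomConstants_of_slow_point _ hlev hslow hG
  · exact not_geomConstants_neg_of_slow_point (e := fun q : Momentum => squareDispersion 1 (-2 / 10) q - μ) _ hlev hslow hG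

/-- Scan cell `(0.275, −0.1)` (`μ ∈ [−0.7960, −0.7958]`; convex AT the level, `μ < μ_c(−0.1) = −0.784`, round 4 `farGamma_hypA3`):
the inflected shell `μ' = −0.77 ∈ (μ_c, 4t′)` lies within `0.026 < klE0 = 1/32` of `μ` ⇒ NO ticket on the engine's top-scale tube
`{|e| < klE0}`, either orientation, any floors. [folklore] -/
theorem cell_d0275_tpm01_no_klE0_ticket {μ g₀ w : ℝ} (hμ : μ ∈ Icc (-0.7960 : ℝ) (-0.7958)) :
    ¬ KLGeomTicketTP (-1 / 10) μ KLRegimeSplit.klE0 g₀ w :=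
  not_ticket_of_inflected_shell (μ' := -77 / 100) (by norm_num) (by norm_num) (by norm_num [convexityReturnLevel]) (by norm_num)
    (by rw [KLRegimeSplit.klE0, abs_lt]; constructor <;> linarith [hμ.1, hμ.2])

/-- (iii)-column node `(1/8, −0.04)` (`μ ∈ [−0.3228, −0.3227]`, `μ_c(−0.04) = −0.318976`; convex at the level by `0.0038`):
the inflected shell `μ' = −0.3` lies within `0.023 < klE0` ⇒ NO top-scale ticket. [folklore] -/
theorem node_d0125_tpm004_no_klE0_ticket {μ g₀ w : ℝ} (hμ : μ ∈ Icc (-0.3228 : ℝ) (-0.3227)) :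
    ¬ KLGeomTicketTP (-4 / 100) μ KLRegimeSplit.klE0 g₀ w :=
  not_ticket_of_inflected_shell (μ' := -3 / 10) (by norm_num) (by norm_num) (by norm_num [convexityReturnLevel]) (by norm_num)
    (by rw [KLRegimeSplit.klE0, abs_lt]; constructor <;> linarith [hμ.1, hμ.2])

/-- Scan cell `(0.30, −0.1)` (`μ ∈ [−0.8619, −0.8617]`, convexity-return distance `0.078 > 3/80`: ADMISSIBLE): every electron-
orientation ticket on the `3/80`-tube has `w ≤ 0.022` (diagonal point `cos x_d = 0.211` of the shell `μ' = −0.8261916`), against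
`w = 0.3418` available to its `t′ = 0` sibling `(0.30, 0)` and FrameOK's post-shift demand `3/200`. [folklore] -/
theorem cell_d030_tpm01_wmin_le {μ K g₀ w : ℝ} (hμ : μ ∈ Icc (-0.8619 : ℝ) (-0.8617))
    (hG : FermiRG.GeomConstants (fun q : Momentum => squareDispersion 1 (-1 / 10) q - μ) K (3 / 80) g₀ w) : w ≤ 22 / 1000 := by
  set x : ℝ := arccos (211 / 1000) with hx
  have hcos : cos x = 211 / 1000 := cos_arccos (by norm_num) (by norm_num)
  have hx0 : 0 < x := arccos_pos.mpr (by norm_num)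
  have hxπ : x < π := arccos_lt_pi.mpr (by norm_num)
  have hlev : squareDispersion 1 (-1 / 10) (mk x x) = -8261916 / 10000000 := by rw [squareDispersion_diag, hcos]; norm_num
  have h := wmin_le_nodal (tp := -1 / 10) (by rw [abs_lt]; constructor <;> norm_num) hx0 hxπ hG hlev
    (by rw [abs_lt]; constructor <;> linarith [hμ.1, hμ.2])
  rw [hcos] at h
  linarith

/-- Director target 1, scan cell `(1/8, −0.3)` (`μ ∈ [−0.9597, −0.9595]`, M side: `μ > 4t′ = −1.2`): the ELECTRON orientation has
no ticket at ANY radius (the level itself is a hole-like shell); the HOLE orientation `μ − ε_{−0.3}` satisfies (A3)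
(`Mside_hypA3_neg`, round 4) and is the ticket to type (float floors on the `3/80`-tube: `g₀ ≥ 1.12`, `w ≥ 0.49`). [folklore] -/
theorem cell_d0125_tpm03_electron_orientation_no_ticket {μ r₀ K g₀ w : ℝ} (hμ : μ ∈ Icc (-0.9597 : ℝ) (-0.9595)) (hr : 0 < r₀) :
    ¬ FermiRG.GeomConstants (fun q : Momentum => squareDispersion 1 (-3 / 10) q - μ) K r₀ g₀ w :=
  not_geomConstants_pos_of_Mside_shell (μ' := μ) (by norm_num) (by norm_num) (by linarith [hμ.1])
    (by rw [abs_of_neg (by norm_num : (-3 / 10 : ℝ) < 0)]; nlinarith [hμ.2]) (by linarith [hμ.2]) (by simpa using hr)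

/-- … and its hole orientation passes FST II (A3) (by name, round 4). [folklore] -/
theorem cell_d0125_tpm03_hole_orientation_hypA3 {μ : ℝ} (hμ : μ ∈ Icc (-0.9597 : ℝ) (-0.9595)) :
    FermiRG.HypA3 (fun q : Momentum => -(squareDispersion 1 (-3 / 10) q - μ)) :=
  Mside_hypA3_neg (by norm_num) (by norm_num) (by linarith [hμ.1])
    (by rw [abs_of_neg (by norm_num : (-3 / 10 : ℝ) < 0)]; nlinarith [hμ.2])

end Summit.HubbardSuperconductivity.HubbardSuperconductivity.Theorems.KlTPrimeGeomTicket

end
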